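import Summits.AnomalousDissipation.AnomalousDissipation.Theorems.SawtoothPulseCascadeK1LocalisedCascadeSlotUngauge
import Summits.AnomalousDissipation.AnomalousDissipation.Theorems.SawtoothPulseCascadeK1LocalisedCascadeSlotTwoBranch
import Literature.Analysis.FluidPDE.PassiveScalarShearFibreDamping

/-!
# K1loc, line `Spectral` / SeqCone — helper: UN-GAUGING THE TWO FLAT-STRIP FAMILIES, SUMMED OVER FIBRES (T1, third brick)

Helper file of the prover lane on the crux `K1LocalisedCascade` (stmt-AnomalousDissipation-19491), route
`SawtoothPulseCascade` (memo v4 §3, target T1 = slot lemma ∘ un-gauging).  After the slot lemma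
(`…SlotCascade`) the localised scalar is known through `θ = X(x_j)·(w(t⁺) ∘ Φ⁻¹)`; the next slot needs the symbol
energy of `θ ∘ Φ` (`Φ = shearMap i j P`, `P = amp U_j γ`) restricted to the two flat-strip families `X⁺(x_j)`,
`X⁻(x_j)` (slopes `±γ`; the zone part is junked first, `…SlotRestart`).  On the fibre `k_i = n` the shear acts by the
phase `g_n(x_j)` (`comp_shearMap_of_fibre`), which on the `±` strips is the modulation `e_{∓b^±_n e_j}` up to a slowly
varying multiplier (`…SlotUngauge`); the two-branch step with its cross term discharged (`…SlotTwoBranch`) bounds the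
fibre's symbol energy, and the fibres are summed by orthogonality (`tsum_symbol_sq_sum_eq_of_fibre`) and finite
Minkowski (`sqrt_sum_add_sq_le`).  Result (`tsum_symbol_sq_twoStrip_le_of_band`, band-limited `θ`):
  `Σ' m²|𝓕((X⁺+X⁻)(x_j)·(θ∘Φ))|² ≤ (‖m⁺(D)θ‖ + A⁺‖θ‖)² + (‖m⁻(D)θ‖ + A⁻‖θ‖)² + 2C‖θ‖²`,
with the FIBREWISE-SHIFTED symbols `m^±(k) = m(k − b^±_{k_i} e_j)` and per-fibre commutator constants `A^±, C`
(suprema over the fibres of the `ω`- and `ω₂`-moments of the un-gauging multipliers).  No definitions; no statement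
about the stub.
[cite: Grafakos2014, Prop. 3.1.2 (5) (coefficients of products, translations and modulations) and Prop. 3.2.7 (3)
(Parseval)] [problem: turb]
-/

-- `Summit.<Summit>.<Problem>`: single-conjunct summit, the duplicate namespace segment is deliberate.
set_option linter.dupNamespace false

noncomputable section

namespace Summit.AnomalousDissipation.AnomalousDissipation.Theorems.SawtoothPulseCascade.K1Slot

open MeasureTheory Set Filter Topology UnitAddTorus Function
open scoped ComplexConjugate
open Literature.Analysis Literature.Analysis.FunctionSpaces Literature.Analysis.FunctionSpaces.Torus
open Summit.AnomalousDissipation.AnomalousDissipation.Theorems.SawtoothPulseCascade.SpectralLeakage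

variable {d : Type*} [Fintype d] [DecidableEq d]

/-! ## Fibre bookkeeping -/

/-- **Monochromatic functions are eigenfunctions of the axis translations**: if all modes of a smooth `θ` have
`i`-th frequency `n`, then `θ(x + s eᵢ) = e_n(s) θ(x)`. [cite: Grafakos2014, Prop. 3.1.2 (5)] -/
theorem apply_add_single_of_fibre {θ : UnitAddTorus d → ℂ} {i : d} (hθ : IsSmooth θ) {n : ℤ}
    (hn : ∀ k, mFourierCoeff θ k ≠ 0 → k i = n) (s : UnitAddCircle) (x : UnitAddTorus d) :
    θ (x + Pi.single i s) = fourier n s * θ x := by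
  have hs : Summable (mFourierCoeff ((⟨θ, hθ.continuous⟩ : C(UnitAddTorus d, ℂ)) : UnitAddTorus d → ℂ)) :=
    hθ.rapidDecay_mFourierCoeff.summable
  have h1 : HasSum (fun k => mFourierCoeff θ k • mFourier k (x + Pi.single i s)) (θ (x + Pi.single i s)) :=
    hasSum_mFourier_series_apply_of_summable hs _
  have h2 : HasSum (fun k => fourier n s * (mFourierCoeff θ k • mFourier k x)) (fourier n s * θ x) :=
    (hasSum_mFourier_series_apply_of_summable hs x).mul_left (fourier n s)
  have heq : (fun k => mFourierCoeff θ k • mFourier k (x + Pi.single i s)) =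
      fun k => fourier n s * (mFourierCoeff θ k • mFourier k x) := by
    funext k
    by_cases hk : mFourierCoeff θ k = 0
    · simp [hk]
    · rw [mFourier_add_single, hn k hk, smul_eq_mul, smul_eq_mul]; ring
  rw [heq] at h1
  exact h1.unique h2

/-- **Axis-invariant multipliers preserve fibres**: if `Ξ(x + s eᵢ) = Ξ(x)` and the smooth `θ` has its modes on the
fibre `kᵢ = n`, then so does `Ξ·θ`. [cite: Grafakos2014, Prop. 3.1.2 (5)] -/
theorem mFourierCoeff_mul_eq_zero_of_fibre {Ξ θ : UnitAddTorus d → ℂ} {i : d}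
    (hΞ : ∀ (s : UnitAddCircle) (x : UnitAddTorus d), Ξ (x + Pi.single i s) = Ξ x) (hθ : IsSmooth θ) {n : ℤ}
    (hn : ∀ k, mFourierCoeff θ k ≠ 0 → k i = n) {k : d → ℤ} (hk : k i ≠ n) :
    mFourierCoeff (fun x => Ξ x * θ x) k = 0 :=
  FluidPDE.Torus.mFourierCoeff_eq_zero_of_forall_add_single_eq_fourier_mul (fun s x => by
    show Ξ (x + Pi.single i s) * θ (x + Pi.single i s) = fourier n s * (Ξ x * θ x)
    rw [hΞ, apply_add_single_of_fibre hθ hn]; ring) hk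

omit [DecidableEq d] in
/-- Changing the symbol off the spectrum does not change a symbol energy. [folklore] -/
theorem tsum_symbol_sq_congr_of_supp {F : UnitAddTorus d → ℂ} {μ ν : (d → ℤ) → ℝ}
    (h : ∀ k, mFourierCoeff F k ≠ 0 → μ k ^ 2 = ν k ^ 2) :
    ∑' k, μ k ^ 2 * ‖mFourierCoeff F k‖ ^ 2 = ∑' k, ν k ^ 2 * ‖mFourierCoeff F k‖ ^ 2 := by
  refine tsum_congr fun k => ?_
  by_cases hk : mFourierCoeff F k = 0
  · simp [hk]
  · rw [h k hk]

omit [Fintype d] [DecidableEq d] in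
/-- Finite Minkowski, squared form: `∑(a+b)² ≤ (√∑a² + √∑b²)²` for nonnegative families. [folklore] -/
theorem sum_add_sq_le {ι : Type*} (s : Finset ι) {a b : ι → ℝ} (ha : ∀ n ∈ s, 0 ≤ a n) (hb : ∀ n ∈ s, 0 ≤ b n) :
    ∑ n ∈ s, (a n + b n) ^ 2 ≤ (Real.sqrt (∑ n ∈ s, a n ^ 2) + Real.sqrt (∑ n ∈ s, b n ^ 2)) ^ 2 := by
  have h := sqrt_sum_add_sq_le s ha hb
  have h0 : 0 ≤ ∑ n ∈ s, (a n + b n) ^ 2 := Finset.sum_nonneg fun n _ => sq_nonneg _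
  calc ∑ n ∈ s, (a n + b n) ^ 2 = (Real.sqrt (∑ n ∈ s, (a n + b n) ^ 2)) ^ 2 := (Real.sq_sqrt h0).symm
    _ ≤ _ := pow_le_pow_left₀ (Real.sqrt_nonneg _) h 2

/-- The product of two disjoint real cut-offs read off `x_j` vanishes on the torus. [folklore] -/
theorem onCircle_mul_onCircle_eq_zero {Xp Xm : ShearProfile} (hdis : ∀ y, Xp y * Xm y = 0) (b : UnitAddCircle) :
    (Xp.onCircle b : ℂ) * Xm.onCircle b = 0 := by
  induction b using QuotientAddGroup.induction_on with
  | H y => rw [ShearProfile.onCircle_coe, ShearProfile.onCircle_coe, ← Complex.ofReal_mul, hdis y, Complex.ofReal_zero]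

/-- The un-gauging multipliers of two disjoint strip families are disjoint: `conj Θ⁺ · Θ⁻ = 0`. [folklore] -/
theorem conj_ungaugeMultiplier_mul_eq_zero (P : ShearProfile) {Xp Xm : ShearProfile} (hdis : ∀ y, Xp y * Xm y = 0)
    (n : ℤ) (j : d) (bp bm : ℤ) (x : UnitAddTorus d) :
    conj ((Xp.onCircle (x j) : ℂ) * twist P n (x j) * mFourier (Pi.single j bp) x) *
      ((Xm.onCircle (x j) : ℂ) * twist P n (x j) * mFourier (Pi.single j bm) x) = 0 := by
  have h0 := onCircle_mul_onCircle_eq_zero hdis (x j)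
  rw [map_mul, map_mul, Complex.conj_ofReal]
  calc (Xp.onCircle (x j) : ℂ) * conj (twist P n (x j)) * conj (mFourier (Pi.single j bp) x) *
        ((Xm.onCircle (x j) : ℂ) * twist P n (x j) * mFourier (Pi.single j bm) x)
      = ((Xp.onCircle (x j) : ℂ) * Xm.onCircle (x j)) *
          (conj (twist P n (x j)) * conj (mFourier (Pi.single j bp) x) * twist P n (x j) * mFourier (Pi.single j bm) x) := by
        ring
    _ = 0 := by rw [h0, zero_mul]

/-! ## The band-limited two-strip estimate from a per-fibre estimate -/

/-- **Two-strip symbol energies summed over fibres, band-limited case.**  Let `θ : T^d → ℂ` be smooth with its `i`-th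
frequencies in a finite set `s`, `Φ = shearMap i j P` a transversal shear (`i ≠ j`), `X⁺, X⁻` two profiles read off
`x_j`, `b⁺, b⁻ : ℤ → ℤ` integer shifts per fibre and `m` a real symbol (`|m| ≤ M`).  SUPPOSE the per-fibre estimate: for
every `n ∈ s` and every smooth `G` with modes on the fibre `k_i = n`,
`Σ' m²|𝓕((X⁺+X⁻)(x_j)·(G∘Φ))|² ≤ (√Σ' m(k − b⁺_n e_j)²|𝓕G|² + A⁺‖G‖)² + (√Σ' m(k − b⁻_n e_j)²|𝓕G|² + A⁻‖G‖)² + 2C‖G‖²`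
(discharged by un-gauging + the two-branch step in `tsum_symbol_sq_twoStrip_le_of_band`, or by any sharper per-fibre
commutator analysis).  Then, with the fibrewise-shifted symbols `m^±(k) = m(k − b^±_{k_i} e_j)`,
`Σ'ₖ m_k² ‖𝓕((X⁺+X⁻)(x_j)·(θ∘Φ))(k)‖² ≤ (√Σ' m⁺²‖𝓕θ‖² + A⁺‖θ‖)² + (√Σ' m⁻²‖𝓕θ‖² + A⁻‖θ‖)² + 2C ∫‖θ‖²`
(fibre decomposition, orthogonality of fibres on both sides, finite Minkowski).
[cite: Grafakos2014, Prop. 3.1.2 (5) and Prop. 3.2.7 (3)] -/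
theorem tsum_symbol_sq_twoStrip_le_of_band_of_fibre {θ : UnitAddTorus d → ℂ} {i j : d} (hθ : IsSmooth θ)
    (hij : i ≠ j) (s : Finset ℤ) (hband : ∀ k, mFourierCoeff θ k ≠ 0 → k i ∈ s) (P Xp Xm : ShearProfile)
    (bp bm : ℤ → ℤ) {m : (d → ℤ) → ℝ} {M : ℝ} (hmM : ∀ k, |m k| ≤ M) {Ap Am C : ℝ} (hAp0 : 0 ≤ Ap) (hAm0 : 0 ≤ Am)
    (hfib : ∀ n ∈ s, ∀ G : UnitAddTorus d → ℂ, IsSmooth G → (∀ k, mFourierCoeff G k ≠ 0 → k i = n) →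
      ∑' k, m k ^ 2 * ‖mFourierCoeff (fun x => ((Xp.onCircle (x j) : ℂ) + Xm.onCircle (x j)) * G (shearMap i j P x)) k‖ ^ 2 ≤
        (Real.sqrt (∑' k, m (k - Pi.single j (bp n)) ^ 2 * ‖mFourierCoeff G k‖ ^ 2) + Ap * Real.sqrt (∫ x, ‖G x‖ ^ 2)) ^ 2 +
          (Real.sqrt (∑' k, m (k - Pi.single j (bm n)) ^ 2 * ‖mFourierCoeff G k‖ ^ 2) + Am * Real.sqrt (∫ x, ‖G x‖ ^ 2)) ^ 2 +
          2 * C * ∫ x, ‖G x‖ ^ 2) :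
    ∑' k, m k ^ 2 * ‖mFourierCoeff (fun x => ((Xp.onCircle (x j) : ℂ) + Xm.onCircle (x j)) * θ (shearMap i j P x)) k‖ ^ 2 ≤
      (Real.sqrt (∑' k, m (k - Pi.single j (bp (k i))) ^ 2 * ‖mFourierCoeff θ k‖ ^ 2) + Ap * Real.sqrt (∫ x, ‖θ x‖ ^ 2)) ^ 2 +
        (Real.sqrt (∑' k, m (k - Pi.single j (bm (k i))) ^ 2 * ‖mFourierCoeff θ k‖ ^ 2) + Am * Real.sqrt (∫ x, ‖θ x‖ ^ 2)) ^ 2 +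
        2 * C * ∫ x, ‖θ x‖ ^ 2 := by
  classical
  -- fibre pieces of `θ`
  set θn : ℤ → UnitAddTorus d → ℂ := fun n => modePiece (fibre i n) θ with hθn_def
  have hθn_smooth : ∀ n, IsSmooth (θn n) := fun n => isSmooth_modePiece hθ _
  have hθn_supp : ∀ n, ∀ k, mFourierCoeff (θn n) k ≠ 0 → k i = n := by
    intro n k hk
    rw [hθn_def, mFourierCoeff_modePiece hθ] at hk
    by_contra h
    exact hk (Set.indicator_of_notMem (show k ∉ fibre i n from h) _)
  have hθsum : θ = ∑ n ∈ s, θn n :=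
    eq_sum_modePiece hθ s (fibre i) (pairwiseDisjoint_fibre i _) fun k hk => ⟨k i, hband k hk, rfl⟩
  have hθfun : θ = fun x => ∑ n ∈ s, θn n x := by
    rw [hθsum]; funext x; exact Finset.sum_apply x s θn
  -- the pieces of `H = (X⁺+X⁻)(x_j)·(θ∘Φ)`
  set Hn : ℤ → UnitAddTorus d → ℂ := fun n x =>
    ((Xp.onCircle (x j) : ℂ) + Xm.onCircle (x j)) * θn n (shearMap i j P x) with hHn_def
  have hΞ_smooth : IsSmooth (fun x : UnitAddTorus d => (Xp.onCircle (x j) : ℂ) + Xm.onCircle (x j)) :=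
    (isSmooth_onCircle_comp' Xp j).ofReal_comp.add (isSmooth_onCircle_comp' Xm j).ofReal_comp
  have hΞ_inv : ∀ (t : UnitAddCircle) (x : UnitAddTorus d),
      ((Xp.onCircle ((x + Pi.single i t : UnitAddTorus d) j) : ℂ) +
          Xm.onCircle ((x + Pi.single i t : UnitAddTorus d) j)) =
        (Xp.onCircle (x j) : ℂ) + Xm.onCircle (x j) := fun t x => by
    simp [Pi.single_eq_of_ne hij.symm]
  have hψn_smooth : ∀ n, IsSmooth (θn n ∘ shearMap i j P) := fun n => (hθn_smooth n).comp_shearMap i j P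
  have hψn_supp : ∀ n, ∀ k, mFourierCoeff (θn n ∘ shearMap i j P) k ≠ 0 → k i = n := by
    intro n k hk
    by_contra h
    exact hk (mFourierCoeff_comp_shearMap_eq_zero_of_apply_not_mem (hθn_smooth n).continuous
      (hθn_smooth n).rapidDecay_mFourierCoeff.summable_norm hij P (A := {n})
      (fun k' hk' => not_not.1 fun h' => hk' (hθn_supp n k' h')) h)
  have hHn_smooth : ∀ n, IsSmooth (Hn n) := fun n => hΞ_smooth.mul (hψn_smooth n)
  have hHn_supp : ∀ n, ∀ k, mFourierCoeff (Hn n) k ≠ 0 → k i = n := by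
    intro n k hk
    by_contra h
    exact hk (mFourierCoeff_mul_eq_zero_of_fibre (θ := θn n ∘ shearMap i j P) hΞ_inv (hψn_smooth n) (hψn_supp n) h)
  have hH : (fun x => ((Xp.onCircle (x j) : ℂ) + Xm.onCircle (x j)) * θ (shearMap i j P x)) =
      fun x => ∑ n ∈ s, Hn n x := by
    funext x
    rw [hθfun]
    simp only [hHn_def, Finset.mul_sum]
  -- fibrewise weighted Parseval for `H` and for `θ` with the two shifted symbols
  obtain ⟨_, hHeq⟩ := tsum_symbol_sq_sum_eq_of_fibre i s (f := Hn) (fun n _ => hHn_smooth n)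
    (fun n _ => hHn_supp n) hmM
  have hmpM : ∀ k : d → ℤ, |m (k - Pi.single j (bp (k i)))| ≤ M := fun k => hmM _
  have hmmM : ∀ k : d → ℤ, |m (k - Pi.single j (bm (k i)))| ≤ M := fun k => hmM _
  obtain ⟨_, hθpeq⟩ := tsum_symbol_sq_sum_eq_of_fibre i s (f := θn) (fun n _ => hθn_smooth n)
    (fun n _ => hθn_supp n) hmpM
  obtain ⟨_, hθmeq⟩ := tsum_symbol_sq_sum_eq_of_fibre i s (f := θn) (fun n _ => hθn_smooth n)
    (fun n _ => hθn_supp n) hmmM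
  -- per-fibre quantities
  set ap : ℤ → ℝ := fun n => Real.sqrt (∑' k, m (k - Pi.single j (bp (k i))) ^ 2 * ‖mFourierCoeff (θn n) k‖ ^ 2)
    with hap_def
  set am : ℤ → ℝ := fun n => Real.sqrt (∑' k, m (k - Pi.single j (bm (k i))) ^ 2 * ‖mFourierCoeff (θn n) k‖ ^ 2)
    with ham_def
  set g : ℤ → ℝ := fun n => Real.sqrt (∫ x, ‖θn n x‖ ^ 2) with hg_def
  have hg0 : ∀ n, 0 ≤ g n := fun n => Real.sqrt_nonneg _
  have hg2 : ∀ n, g n ^ 2 = ∫ x, ‖θn n x‖ ^ 2 := fun n => Real.sq_sqrt (integral_nonneg fun x => by positivity)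
  -- the per-fibre estimate, with the shift read off the fibre
  have hfib' : ∀ n ∈ s, ∑' k, m k ^ 2 * ‖mFourierCoeff (Hn n) k‖ ^ 2 ≤
      (ap n + Ap * g n) ^ 2 + (am n + Am * g n) ^ 2 + 2 * C * g n ^ 2 := by
    intro n hn
    have h := hfib n hn (θn n) (hθn_smooth n) (hθn_supp n)
    have hRp : ∑' k, m (k - Pi.single j (bp n)) ^ 2 * ‖mFourierCoeff (θn n) k‖ ^ 2 =
        ∑' k, m (k - Pi.single j (bp (k i))) ^ 2 * ‖mFourierCoeff (θn n) k‖ ^ 2 :=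
      tsum_symbol_sq_congr_of_supp fun k hk => by rw [hθn_supp n k hk]
    have hRm : ∑' k, m (k - Pi.single j (bm n)) ^ 2 * ‖mFourierCoeff (θn n) k‖ ^ 2 =
        ∑' k, m (k - Pi.single j (bm (k i))) ^ 2 * ‖mFourierCoeff (θn n) k‖ ^ 2 :=
      tsum_symbol_sq_congr_of_supp fun k hk => by rw [hθn_supp n k hk]
    have hapn : Real.sqrt (∑' k, m (k - Pi.single j (bp (k i))) ^ 2 * ‖mFourierCoeff (θn n) k‖ ^ 2) = ap n := rfl
    have hamn : Real.sqrt (∑' k, m (k - Pi.single j (bm (k i))) ^ 2 * ‖mFourierCoeff (θn n) k‖ ^ 2) = am n := rfl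
    have hgn : Real.sqrt (∫ x, ‖θn n x‖ ^ 2) = g n := rfl
    rw [hRp, hRm, hapn, hamn, hgn, ← hg2 n] at h
    exact h
  -- Parseval across fibres for the `L²` norms
  have hL2 : ∑ n ∈ s, ∫ x, ‖θn n x‖ ^ 2 = ∫ x, ‖θ x‖ ^ 2 := by
    rw [← integral_norm_sq_sum_eq_of_fibre i s (fun n _ => hθn_smooth n) (fun n _ => hθn_supp n)]
    have hint : (fun x => ‖θ x‖ ^ 2) = fun x => ‖∑ n ∈ s, θn n x‖ ^ 2 := by
      funext x; rw [hθfun]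
    rw [hint]
  have hg_sq : ∑ n ∈ s, g n ^ 2 = ∫ x, ‖θ x‖ ^ 2 := by
    rw [← hL2]; exact Finset.sum_congr rfl fun n _ => hg2 n
  have hAg_sq : ∀ A : ℝ, 0 ≤ A → Real.sqrt (∑ n ∈ s, (A * g n) ^ 2) = A * Real.sqrt (∫ x, ‖θ x‖ ^ 2) := by
    intro A hA
    have h : ∑ n ∈ s, (A * g n) ^ 2 = A ^ 2 * ∫ x, ‖θ x‖ ^ 2 := by
      rw [← hg_sq, Finset.mul_sum]
      exact Finset.sum_congr rfl fun n _ => by ring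
    rw [h, Real.sqrt_mul' _ (integral_nonneg fun x => by positivity), Real.sqrt_sq hA]
  have hap_sq : ∑ n ∈ s, ap n ^ 2 = ∑' k, m (k - Pi.single j (bp (k i))) ^ 2 * ‖mFourierCoeff θ k‖ ^ 2 := by
    rw [show (∑' k, m (k - Pi.single j (bp (k i))) ^ 2 * ‖mFourierCoeff θ k‖ ^ 2) =
        ∑ n ∈ s, ∑' k, m (k - Pi.single j (bp (k i))) ^ 2 * ‖mFourierCoeff (θn n) k‖ ^ 2 by rw [← hθpeq, ← hθfun]]
    exact Finset.sum_congr rfl fun n _ => Real.sq_sqrt (tsum_nonneg fun k => by positivity)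
  have ham_sq : ∑ n ∈ s, am n ^ 2 = ∑' k, m (k - Pi.single j (bm (k i))) ^ 2 * ‖mFourierCoeff θ k‖ ^ 2 := by
    rw [show (∑' k, m (k - Pi.single j (bm (k i))) ^ 2 * ‖mFourierCoeff θ k‖ ^ 2) =
        ∑ n ∈ s, ∑' k, m (k - Pi.single j (bm (k i))) ^ 2 * ‖mFourierCoeff (θn n) k‖ ^ 2 by rw [← hθmeq, ← hθfun]]
    exact Finset.sum_congr rfl fun n _ => Real.sq_sqrt (tsum_nonneg fun k => by positivity)
  -- assemble
  have hMp : ∑ n ∈ s, (ap n + Ap * g n) ^ 2 ≤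
      (Real.sqrt (∑' k, m (k - Pi.single j (bp (k i))) ^ 2 * ‖mFourierCoeff θ k‖ ^ 2) +
        Ap * Real.sqrt (∫ x, ‖θ x‖ ^ 2)) ^ 2 := by
    have h := sum_add_sq_le s (a := ap) (b := fun n => Ap * g n) (fun n _ => Real.sqrt_nonneg _)
      (fun n _ => mul_nonneg hAp0 (hg0 n))
    rwa [hap_sq, hAg_sq Ap hAp0] at h
  have hMm : ∑ n ∈ s, (am n + Am * g n) ^ 2 ≤
      (Real.sqrt (∑' k, m (k - Pi.single j (bm (k i))) ^ 2 * ‖mFourierCoeff θ k‖ ^ 2) +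
        Am * Real.sqrt (∫ x, ‖θ x‖ ^ 2)) ^ 2 := by
    have h := sum_add_sq_le s (a := am) (b := fun n => Am * g n) (fun n _ => Real.sqrt_nonneg _)
      (fun n _ => mul_nonneg hAm0 (hg0 n))
    rwa [ham_sq, hAg_sq Am hAm0] at h
  have hMc : ∑ n ∈ s, 2 * C * g n ^ 2 = 2 * C * ∫ x, ‖θ x‖ ^ 2 := by
    rw [← hg_sq, Finset.mul_sum]
  calc ∑' k, m k ^ 2 * ‖mFourierCoeff (fun x => ((Xp.onCircle (x j) : ℂ) + Xm.onCircle (x j)) *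
          θ (shearMap i j P x)) k‖ ^ 2
      = ∑ n ∈ s, ∑' k, m k ^ 2 * ‖mFourierCoeff (Hn n) k‖ ^ 2 := by rw [hH, hHeq]
    _ ≤ ∑ n ∈ s, ((ap n + Ap * g n) ^ 2 + (am n + Am * g n) ^ 2 + 2 * C * g n ^ 2) := Finset.sum_le_sum hfib'
    _ = ∑ n ∈ s, (ap n + Ap * g n) ^ 2 + ∑ n ∈ s, (am n + Am * g n) ^ 2 + ∑ n ∈ s, 2 * C * g n ^ 2 := by
        rw [Finset.sum_add_distrib, Finset.sum_add_distrib]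
    _ ≤ _ := by rw [hMc]; linarith

/-! ## The `√`-form under the compatibility of symbols -/

omit [Fintype d] [DecidableEq d] in
/-- Minkowski in `ℝ²`, squared: `(a+b)² + (c+e)² ≤ (√(a²+c²) + √(b²+e²))²` for nonnegative reals. [folklore] -/
theorem add_sq_add_add_sq_le {a b c e : ℝ} (ha : 0 ≤ a) (hb : 0 ≤ b) (hc : 0 ≤ c) (he : 0 ≤ e) :
    (a + b) ^ 2 + (c + e) ^ 2 ≤ (Real.sqrt (a ^ 2 + c ^ 2) + Real.sqrt (b ^ 2 + e ^ 2)) ^ 2 := by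
  have h1 : 0 ≤ a ^ 2 + c ^ 2 := by positivity
  have h2 : 0 ≤ b ^ 2 + e ^ 2 := by positivity
  have hs1 := Real.sq_sqrt h1
  have hs2 := Real.sq_sqrt h2
  have hr1 := Real.sqrt_nonneg (a ^ 2 + c ^ 2)
  have hr2 := Real.sqrt_nonneg (b ^ 2 + e ^ 2)
  -- Cauchy–Schwarz `ab + ce ≤ √(a²+c²) √(b²+e²)`
  have hCS : a * b + c * e ≤ Real.sqrt (a ^ 2 + c ^ 2) * Real.sqrt (b ^ 2 + e ^ 2) := by
    have h0 : 0 ≤ a * b + c * e := by positivity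
    have hsq : (a * b + c * e) ^ 2 ≤ (Real.sqrt (a ^ 2 + c ^ 2) * Real.sqrt (b ^ 2 + e ^ 2)) ^ 2 := by
      rw [mul_pow, hs1, hs2]; nlinarith [sq_nonneg (a * e - c * b)]
    exact (pow_le_pow_iff_left₀ h0 (mul_nonneg hr1 hr2) two_ne_zero).mp hsq
  nlinarith

omit [DecidableEq d] in
/-- A bounded symbol has a summable symbol energy on a continuous function (Parseval). [folklore] -/
theorem summable_symbol_sq {F : UnitAddTorus d → ℂ} (hF : Continuous F) {m : (d → ℤ) → ℝ} {M : ℝ}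
    (hmM : ∀ k, |m k| ≤ M) : Summable fun k => m k ^ 2 * ‖mFourierCoeff F k‖ ^ 2 := by
  have hm2 : ∀ k, m k ^ 2 ≤ M ^ 2 := fun k => by
    rw [← sq_abs]; exact pow_le_pow_left₀ (abs_nonneg _) (hmM k) 2
  exact ((hasSum_sq_mFourierCoeff_of_continuous hF).summable.mul_left (M ^ 2)).of_nonneg_of_le
    (fun k => by positivity) fun k => mul_le_mul_of_nonneg_right (hm2 k) (sq_nonneg _)

omit [Fintype d] [DecidableEq d] in
/-- **The `√`-step** (pure real bookkeeping): from `L ≤ (√E⁺ + A⁺√G)² + (√E⁻ + A⁻√G)² + 2CG` and `E⁺ + E⁻ ≤ E_μ`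
conclude `√L ≤ √E_μ + (√(A⁺²+A⁻²) + √(2C)) √G` (Minkowski in `ℝ²` and `√(x+y) ≤ √x + √y`). [folklore] -/
theorem sqrt_le_of_twoStrip_sq_le {L Ep Em Eμ G Ap Am C : ℝ} (hEp0 : 0 ≤ Ep) (hEm0 : 0 ≤ Em) (hG0 : 0 ≤ G)
    (hAp0 : 0 ≤ Ap) (hAm0 : 0 ≤ Am) (hC0 : 0 ≤ C)
    (hL : L ≤ (Real.sqrt Ep + Ap * Real.sqrt G) ^ 2 + (Real.sqrt Em + Am * Real.sqrt G) ^ 2 + 2 * C * G)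
    (hsum : Ep + Em ≤ Eμ) :
    Real.sqrt L ≤ Real.sqrt Eμ + (Real.sqrt (Ap ^ 2 + Am ^ 2) + Real.sqrt (2 * C)) * Real.sqrt G := by
  set g := Real.sqrt G with hg
  have hg0 : 0 ≤ g := Real.sqrt_nonneg _
  have hg2 : g ^ 2 = G := Real.sq_sqrt hG0
  have hM2 := add_sq_add_add_sq_le (Real.sqrt_nonneg Ep) (mul_nonneg hAp0 hg0) (Real.sqrt_nonneg Em) (mul_nonneg hAm0 hg0)
  rw [Real.sq_sqrt hEp0, Real.sq_sqrt hEm0, mul_pow, mul_pow, ← add_mul,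
    Real.sqrt_mul' _ (sq_nonneg g), Real.sqrt_sq hg0] at hM2
  have hroot : Real.sqrt (Ep + Em) ≤ Real.sqrt Eμ := Real.sqrt_le_sqrt hsum
  have hB0 : 0 ≤ Real.sqrt (Ap ^ 2 + Am ^ 2) * g := mul_nonneg (Real.sqrt_nonneg _) hg0
  have hsq : L ≤ (Real.sqrt Eμ + Real.sqrt (Ap ^ 2 + Am ^ 2) * g) ^ 2 + 2 * C * g ^ 2 := by
    have h1 : (Real.sqrt (Ep + Em) + Real.sqrt (Ap ^ 2 + Am ^ 2) * g) ^ 2 ≤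
        (Real.sqrt Eμ + Real.sqrt (Ap ^ 2 + Am ^ 2) * g) ^ 2 :=
      pow_le_pow_left₀ (add_nonneg (Real.sqrt_nonneg _) hB0) (add_le_add hroot le_rfl) 2
    rw [hg2]
    linarith
  calc Real.sqrt L ≤ Real.sqrt ((Real.sqrt Eμ + Real.sqrt (Ap ^ 2 + Am ^ 2) * g) ^ 2 + 2 * C * g ^ 2) :=
        Real.sqrt_le_sqrt hsq
    _ ≤ Real.sqrt ((Real.sqrt Eμ + Real.sqrt (Ap ^ 2 + Am ^ 2) * g) ^ 2) + Real.sqrt (2 * C * g ^ 2) := by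
        -- `√(x + y) ≤ √x + √y`
        have hx : 0 ≤ (Real.sqrt Eμ + Real.sqrt (Ap ^ 2 + Am ^ 2) * g) ^ 2 := sq_nonneg _
        have hy : 0 ≤ 2 * C * g ^ 2 := by positivity
        have h : (Real.sqrt Eμ + Real.sqrt (Ap ^ 2 + Am ^ 2) * g) ^ 2 + 2 * C * g ^ 2 ≤
            (Real.sqrt ((Real.sqrt Eμ + Real.sqrt (Ap ^ 2 + Am ^ 2) * g) ^ 2) + Real.sqrt (2 * C * g ^ 2)) ^ 2 := by
          nlinarith [Real.sq_sqrt hx, Real.sq_sqrt hy, Real.sqrt_nonneg ((Real.sqrt Eμ + Real.sqrt (Ap ^ 2 + Am ^ 2) * g) ^ 2),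
            Real.sqrt_nonneg (2 * C * g ^ 2)]
        calc Real.sqrt ((Real.sqrt Eμ + Real.sqrt (Ap ^ 2 + Am ^ 2) * g) ^ 2 + 2 * C * g ^ 2)
            ≤ Real.sqrt ((Real.sqrt ((Real.sqrt Eμ + Real.sqrt (Ap ^ 2 + Am ^ 2) * g) ^ 2) + Real.sqrt (2 * C * g ^ 2)) ^ 2) :=
              Real.sqrt_le_sqrt h
          _ = _ := Real.sqrt_sq (add_nonneg (Real.sqrt_nonneg _) (Real.sqrt_nonneg _))
    _ = Real.sqrt Eμ + (Real.sqrt (Ap ^ 2 + Am ^ 2) + Real.sqrt (2 * C)) * g := by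
        rw [Real.sqrt_sq (add_nonneg (Real.sqrt_nonneg _) hB0), Real.sqrt_mul' _ (sq_nonneg g), Real.sqrt_sq hg0]
        ring

/-- **The half-slot step in `√`-form under the compatibility of symbols** (band-limited case, abstract per-fibre
estimate).  If the new symbol `m` and the old symbol `μ` (`|μ| ≤ M'`) satisfy
`m(k − b⁺_{k_i}e_j)² + m(k − b⁻_{k_i}e_j)² ≤ μ(k)²` (the two transported cones fit inside the old one), then
`‖m(D)((X⁺+X⁻)(x_j)·(θ∘Φ))‖ ≤ ‖μ(D)θ‖ + (√(A⁺²+A⁻²) + √(2C))‖θ‖` — the un-gauging half of the cascade's half-slot step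
(memo v4 §3, T1), to be composed with the slot lemma (`…SlotCascade`) and the zone junk (`…SlotRestart`).
[cite: Grafakos2014, Prop. 3.1.2 (5) and Prop. 3.2.7 (3)] -/
theorem sqrt_tsum_symbol_sq_twoStrip_le_of_band_of_fibre {θ : UnitAddTorus d → ℂ} {i j : d} (hθ : IsSmooth θ)
    (hij : i ≠ j) (s : Finset ℤ) (hband : ∀ k, mFourierCoeff θ k ≠ 0 → k i ∈ s) (P Xp Xm : ShearProfile)
    (bp bm : ℤ → ℤ) {m : (d → ℤ) → ℝ} {M : ℝ} (hmM : ∀ k, |m k| ≤ M) {Ap Am C : ℝ} (hAp0 : 0 ≤ Ap) (hAm0 : 0 ≤ Am)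
    (hC0 : 0 ≤ C)
    (hfib : ∀ n ∈ s, ∀ G : UnitAddTorus d → ℂ, IsSmooth G → (∀ k, mFourierCoeff G k ≠ 0 → k i = n) →
      ∑' k, m k ^ 2 * ‖mFourierCoeff (fun x => ((Xp.onCircle (x j) : ℂ) + Xm.onCircle (x j)) * G (shearMap i j P x)) k‖ ^ 2 ≤
        (Real.sqrt (∑' k, m (k - Pi.single j (bp n)) ^ 2 * ‖mFourierCoeff G k‖ ^ 2) + Ap * Real.sqrt (∫ x, ‖G x‖ ^ 2)) ^ 2 +
          (Real.sqrt (∑' k, m (k - Pi.single j (bm n)) ^ 2 * ‖mFourierCoeff G k‖ ^ 2) + Am * Real.sqrt (∫ x, ‖G x‖ ^ 2)) ^ 2 +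
          2 * C * ∫ x, ‖G x‖ ^ 2)
    {μ : (d → ℤ) → ℝ} {M' : ℝ} (hμM : ∀ k, |μ k| ≤ M')
    (hcomp : ∀ k : d → ℤ, m (k - Pi.single j (bp (k i))) ^ 2 + m (k - Pi.single j (bm (k i))) ^ 2 ≤ μ k ^ 2) :
    Real.sqrt (∑' k, m k ^ 2 *
        ‖mFourierCoeff (fun x => ((Xp.onCircle (x j) : ℂ) + Xm.onCircle (x j)) * θ (shearMap i j P x)) k‖ ^ 2) ≤
      Real.sqrt (∑' k, μ k ^ 2 * ‖mFourierCoeff θ k‖ ^ 2) +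
        (Real.sqrt (Ap ^ 2 + Am ^ 2) + Real.sqrt (2 * C)) * Real.sqrt (∫ x, ‖θ x‖ ^ 2) := by
  have hmain := tsum_symbol_sq_twoStrip_le_of_band_of_fibre hθ hij s hband P Xp Xm bp bm hmM hAp0 hAm0 hfib
  have hmpM : ∀ k : d → ℤ, |m (k - Pi.single j (bp (k i)))| ≤ M := fun k => hmM _
  have hmmM : ∀ k : d → ℤ, |m (k - Pi.single j (bm (k i)))| ≤ M := fun k => hmM _
  have hsp := summable_symbol_sq hθ.continuous hmpM
  have hsm := summable_symbol_sq hθ.continuous hmmM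
  have hsμ := summable_symbol_sq hθ.continuous hμM
  have hsum2 : ∑' k, m (k - Pi.single j (bp (k i))) ^ 2 * ‖mFourierCoeff θ k‖ ^ 2 +
      ∑' k, m (k - Pi.single j (bm (k i))) ^ 2 * ‖mFourierCoeff θ k‖ ^ 2 ≤ ∑' k, μ k ^ 2 * ‖mFourierCoeff θ k‖ ^ 2 := by
    rw [← hsp.tsum_add hsm]
    exact (hsp.add hsm).tsum_le_tsum (fun k => by
      rw [← add_mul]; exact mul_le_mul_of_nonneg_right (hcomp k) (sq_nonneg _)) hsμ
  exact sqrt_le_of_twoStrip_sq_le (tsum_nonneg fun k => by positivity) (tsum_nonneg fun k => by positivity)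
    (integral_nonneg fun x => by positivity) hAp0 hAm0 hC0 hmain hsum2

end Summit.AnomalousDissipation.AnomalousDissipation.Theorems.SawtoothPulseCascade.K1Slot
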